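import Literature.Analysis.FluidPDE.CKNOneScaleFromRRS
import Literature.Analysis.FluidPDE.CKNLocalRegularityRRSPressure
import HarnessLib

/-!
# The one-scale ε-regularity criterion with a force, proved (discharge of `oneScaleRegularity`),
# and with it Caffarelli–Kohn–Nirenberg's Proposition 2 (`ckn_epsilon_regularity`, ns.S12)

Analysis/FluidPDE proof file (no definitions, no named facts): the discharge of the named fact
`Literature.Analysis.FluidPDE.oneScaleRegularity` of `CKNEpsilonRegularityAssembly.lean` —
Caffarelli–Kohn–Nirenberg 1982, Proposition 1 and its Corollary, in the `L³ × L^{3/2}`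
vocabulary and in qualitative form: there is an absolute `ε₀ > 0` and, for every `q > 5/2`, a
force threshold `κ(q) > 0` such that for a suitable weak solution `(u, p)` (`ν = 1`) on `Q` with a
divergence-free force `f ∈ L^q(Q)` and a cylinder with `closure Q_r(z) ⊆ Q`, the smallness
`C(r) + D(r) ≤ ε₀`, `F_q(r) ≤ κ` gives `u ∈ L^∞(Q_{r/2}(z))`.

The proof is the composition of results already in the tree:

* `oneScaleRegularity_of_theorem15_3_force` (`CKNOneScaleFromRRS`): the fact follows from the
  tree's rendering of Robinson–Rodrigo–Sadowski's first local regularity theorem with a force,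
  `RRS2016.theorem15_3_force` (zoom `Q_r(z)` to `Q_1(0)`; `C`, `D`, `F_q` are scale invariant);
* `RRS2016.theorem15_3_force_holds` (`CKNLocalRegularityRRSPressure`): Theorem 15.3 with force,
  now a theorem — the induction `theorem15_3_force_of_steps` (`CKNLocalRegularityRRS`) over
  Step 1, Step 2 with the force term (`step2_force_holds`, from the cut-off functions of
  Lemma 15.11, `lemma15_11_holds`), Step 3 (`step3_of_lemma15_12`, from the interpolation
  inequality Lemma 15.10 = `interpolationEstimate_holds` and the local pressure estimate
  Lemma 15.12 = `lemma15_12_holds`) and Step 4.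

Consequently the ε-regularity criterion `ckn_epsilon_regularity` of `PartialRegularity.lean`
(ns.S12; Caffarelli–Kohn–Nirenberg 1982, Proposition 2: an absolute `ε` such that
`limsup_{r → 0} r⁻¹ ∫∫_{Q*_r(z)} |∇u|² ≤ ε` makes `z` a regular point) is a theorem,
`ckn_epsilon_regularity_holds`, by the accepted assembly
`ckn_epsilon_regularity_of_theorem15_3_force` (`CKNOneScaleFromRRS`).

This file lives next to `CKNEpsilonRegularityAssembly.lean` rather than inside it because the
proof of `theorem15_3_force` imports that file (through `CKNLocalRegularityRRS` and the
discharged estimates `localEnergyEstimate_holds`, `pressureEstimate_holds`,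
`interpolationEstimate_holds`).

## References

* L. Caffarelli, R. Kohn, L. Nirenberg, *Partial regularity of suitable weak solutions of the
  Navier–Stokes equations*, Comm. Pure Appl. Math. 35 (1982), 771–831: Proposition 1 and its
  Corollary (pp. 776–777), Proposition 2. [CaffarelliKohnNirenberg1982]
* J. C. Robinson, J. L. Rodrigo, W. Sadowski, *The three-dimensional Navier–Stokes equations*,
  Cambridge Studies in Advanced Mathematics 157 (2016): Thm. 15.3 and its proof (Steps 1–4),
  Lemmas 15.10–15.12. [RobinsonRodrigoSadowski2016]
-/

noncomputable section

namespace Literature.Analysis.FluidPDE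

/-- **Caffarelli–Kohn–Nirenberg's Proposition 1 with its Corollary (the one-scale ε-regularity
criterion with a force), proved**: discharge of the named fact `oneScaleRegularity` — an absolute
`ε₀ > 0` and, for every `q > 5/2`, a force threshold `κ(q) > 0` such that for every suitable weak
solution `(u, p)` (`ν = 1`) on an open `Q ⊆ ℝ × ℝ³` with force `f ∈ L^q(Q)`, `div f = 0`, and every
backward cylinder with `closure Q_r(z) ⊆ Q`, the smallness `C(r) + D(r) ≤ ε₀` and `F_q(r) ≤ κ`
imply `u ∈ L^∞(Q_{r/2}(z))`. Obtained from Robinson–Rodrigo–Sadowski's Theorem 15.3 with force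
(`RRS2016.theorem15_3_force_holds`) by the zoom to the unit cylinder
(`oneScaleRegularity_of_theorem15_3_force`). [cite: CaffarelliKohnNirenberg1982, Proposition 1 and Corollary] -/
theorem oneScaleRegularity_holds : oneScaleRegularity :=
  oneScaleRegularity_of_theorem15_3_force RRS2016.theorem15_3_force_holds

/-- **Caffarelli–Kohn–Nirenberg's Proposition 2 (the ε-regularity criterion of ns.S12), proved**:
discharge of the named fact `ckn_epsilon_regularity` of `PartialRegularity.lean` — there is an
absolute `ε > 0` such that for a suitable weak solution `(u, p)` (`ν = 1`) on `Q` with a force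
`f ∈ L^q`, `q > 5/2`, `div f = 0`, every point `z ∈ Q` with
`limsup_{r → 0} r⁻¹ ∫∫_{Q*_r(z)} |∇u|² ≤ ε` is a regular point. It is the accepted assembly
`ckn_epsilon_regularity_of_theorem15_3_force` (`CKNOneScaleFromRRS`: the proved scheme
`ckn_epsilon_regularity_of_estimates` of `CKNEpsilonRegularityAssembly` over the discharged
estimates `localEnergyEstimate_holds`, `pressureEstimate_holds`, `interpolationEstimate_holds` and
`oneScaleRegularity_of_theorem15_3_force`) applied to `RRS2016.theorem15_3_force_holds`.
[cite: CaffarelliKohnNirenberg1982, Proposition 2] -/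
theorem ckn_epsilon_regularity_holds : ckn_epsilon_regularity :=
  ckn_epsilon_regularity_of_theorem15_3_force RRS2016.theorem15_3_force_holds

end Literature.Analysis.FluidPDE

end
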